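import Summits.Ventures.GridStability.Lyapunov.NE39LossySplitLinesU23o1600RecDualKernel
import HarnessLib

/-!
# «NE39-LOSSY-SPLITU-RECORD-CEILING-TIGHT» — kernel file 2 of 2: the dual functionals over `ℚ` and the acceptance tests (D2), (D3),
# (D4), the null channels, the window-point tests — all 200 channels, decided in the kernel (class of record: no `q_k`)

Cell `gridfusion` (39-bus rung, OBSTRUCTION side); seat gridfusion-lit-6 (g11; g10's generator `probes/ne39/gen_ne39_recdual.py` with the TAG patch `probes/rectight/gen_ne39_recdual_v2.py`).  `u_k = (CZ₁₁Cᵀ)_kk`, `v_k = (Z₂₁Cᵀ)_kk`,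
`w_k = (HHᵀ)_kk`, `s_k = (Z₂₁(CA)ᵀ)_kk` (`C·B = 0`);
(D2) `−a0b0·u + (a0+b0)·v − w ≥ 0`, (D3) `a0 ≥ 0 → s ≥ 0`, (D4) `a0 < b0`, `tr Z₁₁ > 0`; diagonal channels: all four functionals
vanish; window points: the exact end-point cosines of `δ*_k ± γ₀` (and the centre `0` on the wide sine channels) against
`a0 / b0`, from the record's exact `cd / sd`.  Nothing here is a statement about a grid.
[cite: BoydVandenberghe2004, §5.9.4 (5.97)–(5.98); Khalil2002, §7.1 Example 7.5]
-/

namespace Summit.Ventures.GridStability.Lyapunov.NE39LossySplitLinesU23o1600RecDual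

open Matrix Literature.Computation.Certificates
open Literature.MathematicalPhysics.PowerSystems.LyapunovFunctionFamily
open Summit.Ventures.GridStability.Models
open Summit.Ventures.GridStability.Lyapunov.NE39LossySplitLines (e1 AQ CQ BLQ)

/-! ### The dual functionals over `ℚ` -/

/-- `u_k = (CZ₁₁Cᵀ)_kk`. -/
def UQᵣ₂ (k : (Fin 10 × Fin 10) ⊕ (Fin 10 × Fin 10)) : ℚ := (CQ * Z11Qᵣ₂ * CQᵀ) k k
/-- `v_k = (Z₂₁Cᵀ)_kk`. -/
def VQᵣ₂ (k : (Fin 10 × Fin 10) ⊕ (Fin 10 × Fin 10)) : ℚ := (Z21Qᵣ₂ * CQᵀ) k k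
/-- `w_k = (Z₂₂)_kk = |H_k|²`. -/
def WQᵣ₂ (k : (Fin 10 × Fin 10) ⊕ (Fin 10 × Fin 10)) : ℚ := Z22Qᵣ₂ k k
/-- `s_k = (Z₂₁(CA)ᵀ)_kk` (`C·B = 0`, so this IS the Popov coefficient). -/
def SQᵣ₂ (k : (Fin 10 × Fin 10) ⊕ (Fin 10 × Fin 10)) : ℚ := (Z21Qᵣ₂ * (CQ * AQ)ᵀ) k k
/-! ### The acceptance tests (kernel) -/

set_option maxHeartbeats 40000000 in
/-- **(D2)** `t_k(a0, b0) ≥ 0` on every channel. -/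
theorem testsD2ᵣ₂ : ∀ k : (Fin 10 × Fin 10) ⊕ (Fin 10 × Fin 10), 0 ≤ -(a0Kᵣ₂ k * b0Kᵣ₂ k) * UQᵣ₂ k + (a0Kᵣ₂ k + b0Kᵣ₂ k) * VQᵣ₂ k - WQᵣ₂ k := by
  decide +kernel

set_option maxHeartbeats 40000000 in
/-- **(D3)** `s_k ≥ 0` on every channel whose lower slope is `≥ 0` (the class of record's Popov sign rule). -/
theorem testsD3ᵣ₂ : ∀ k : (Fin 10 × Fin 10) ⊕ (Fin 10 × Fin 10), 0 ≤ a0Kᵣ₂ k → 0 ≤ SQᵣ₂ k := by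
  decide +kernel

set_option maxHeartbeats 40000000 in
/-- **(D4a)** `a0 < b0`, and on the diagonal channels the five dual functionals vanish. -/
theorem testsD4ᵣ₂ : ∀ k : (Fin 10 × Fin 10) ⊕ (Fin 10 × Fin 10), a0Kᵣ₂ k < b0Kᵣ₂ k ∧
    ((pairOfᵣ₂ k).1 = (pairOfᵣ₂ k).2 → UQᵣ₂ k = 0 ∧ VQᵣ₂ k = 0 ∧ WQᵣ₂ k = 0 ∧ SQᵣ₂ k = 0) := by
  decide +kernel

/-- **The dual scalar tests**, all 200 channels. -/
theorem dual_testsᵣ₂ (k : (Fin 10 × Fin 10) ⊕ (Fin 10 × Fin 10)) :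
    0 ≤ -(a0Kᵣ₂ k * b0Kᵣ₂ k) * UQᵣ₂ k + (a0Kᵣ₂ k + b0Kᵣ₂ k) * VQᵣ₂ k - WQᵣ₂ k ∧
    (0 ≤ a0Kᵣ₂ k → 0 ≤ SQᵣ₂ k) ∧ a0Kᵣ₂ k < b0Kᵣ₂ k ∧
    ((pairOfᵣ₂ k).1 = (pairOfᵣ₂ k).2 → UQᵣ₂ k = 0 ∧ VQᵣ₂ k = 0 ∧ WQᵣ₂ k = 0 ∧ SQᵣ₂ k = 0) :=
  ⟨testsD2ᵣ₂ k, testsD3ᵣ₂ k, (testsD4ᵣ₂ k).1, (testsD4ᵣ₂ k).2⟩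

/-- **(D4b)** `tr Z₁₁ > 0`. -/
theorem trace_testᵣ₂ : 0 < Matrix.trace Z11Qᵣ₂ := by
  decide +kernel

/-! ### The window-point tests over `ℚ` (channels `p ≠ q`) -/

set_option maxHeartbeats 4000000 in
/-- **Sine channels `(p, q)`, `p ≠ q`**: end-point cosines `cd·cg0Qᵣ₂ ∓ sd·sg0Qᵣ₂`; one is `≤ a0`; EITHER one is `≥ b0` (narrow)
OR `ξ = 0` lies in the window (`cg0Qᵣ₂ ≤ cd`) with `b0 ≤ 1` (wide). -/
theorem window_tests_sinᵣ₂ : ∀ p q : Fin 10, p ≠ q →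
    (NE39.preLossless.cd p q * cg0Qᵣ₂ - NE39.preLossless.sd p q * sg0Qᵣ₂ ≤ a0Kᵣ₂ (Sum.inl (p, q)) ∨
      NE39.preLossless.cd p q * cg0Qᵣ₂ + NE39.preLossless.sd p q * sg0Qᵣ₂ ≤ a0Kᵣ₂ (Sum.inl (p, q))) ∧
    ((b0Kᵣ₂ (Sum.inl (p, q)) ≤ NE39.preLossless.cd p q * cg0Qᵣ₂ - NE39.preLossless.sd p q * sg0Qᵣ₂ ∨
      b0Kᵣ₂ (Sum.inl (p, q)) ≤ NE39.preLossless.cd p q * cg0Qᵣ₂ + NE39.preLossless.sd p q * sg0Qᵣ₂) ∨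
      (cg0Qᵣ₂ ≤ NE39.preLossless.cd p q ∧ b0Kᵣ₂ (Sum.inl (p, q)) ≤ 1)) := by
  decide +kernel

set_option maxHeartbeats 4000000 in
/-- **Cosine channels `(p, q)`, `p ≠ q`**: end-point cosines `−sd·cg0Qᵣ₂ ∓ cd·sg0Qᵣ₂`; one is `≤ a0`, one is `≥ b0`. -/
theorem window_tests_cosᵣ₂ : ∀ p q : Fin 10, p ≠ q →
    (-NE39.preLossless.sd p q * cg0Qᵣ₂ - NE39.preLossless.cd p q * sg0Qᵣ₂ ≤ a0Kᵣ₂ (Sum.inr (p, q)) ∨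
      -NE39.preLossless.sd p q * cg0Qᵣ₂ + NE39.preLossless.cd p q * sg0Qᵣ₂ ≤ a0Kᵣ₂ (Sum.inr (p, q))) ∧
    (b0Kᵣ₂ (Sum.inr (p, q)) ≤ -NE39.preLossless.sd p q * cg0Qᵣ₂ - NE39.preLossless.cd p q * sg0Qᵣ₂ ∨
      b0Kᵣ₂ (Sum.inr (p, q)) ≤ -NE39.preLossless.sd p q * cg0Qᵣ₂ + NE39.preLossless.cd p q * sg0Qᵣ₂) := by
  decide +kernel

/-- `0 < u₀ < 1` (so `0 < γ₀ < π/2`). -/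
theorem u0Q_pos_ltᵣ₂ : 0 < u0Qᵣ₂ ∧ u0Qᵣ₂ < 1 := by norm_num [u0Qᵣ₂]

end Summit.Ventures.GridStability.Lyapunov.NE39LossySplitLinesU23o1600RecDual
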